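import Summits.MatrixMultiplication.MatrixMultiplication.Theses.EisensteinValCertificates
import Summits.MatrixMultiplication.MatrixMultiplication.Theses.FourierTwoFamiliesModP
import Literature.Computability.AlgebraicComplexity.SimultaneousDoubleProduct
import Literature.Barriers.MatrixMultiplication.TricoloredSumFreeBarrierEffective
import Summits.MatrixMultiplication.MatrixMultiplication.Theorems.EisensteinValCertificatesHomocyclicSTPPDesignsStubDesignLift

/-!
# Prime two families give LARGE-BLOCK abelian STPP designs (crux stmt-MatrixMultiplication-10647)

Support file of crux `EisensteinValCertificates.HomocyclicSTPPDesigns` (X′).  The large-block transfer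
(`Theorems/EisensteinValCertificatesHomocyclicSTPPDesignsLargeBlockTransfer.lean`) proves
`LargeBlockAbelianDesigns → X′`, where `LargeBlockAbelianDesigns` (crux strategist, SketchStrategist.lean
§3; inlined here, no definition is introduced) says: for ONE `α₀ > 0` and EVERY `ε > 0` some finite abelian
group `H` carries an STPP family beating exponent `(2+ε)/3` whose every block has volume `≥ |H|^{α₀}`.
This file places that statement in the sandwich of design statements around X′:

  `CPackingConstruction ⟺ PrimeTwoFamilies ⟹ LargeBlockAbelianDesigns ⟹ X′ ⟹ CThesis ⟹ ω = 2`,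

by proving `largeBlockAbelianDesigns_of_primeTwoFamilies : PrimeTwoFamilies → LargeBlockAbelianDesigns`
with `α₀ = 1/2`: the CKSU two-families lift (landed stub `DesignLift.stub_designLift`) of the SDPP family of
`PrimeTwoFamilies` (item stmt-MatrixMultiplication-14308) at `δ := ε₀/(8+ε₀)`, `ε₀ := min ε 1`, lives in
`H = Fin 3 → ZMod p`, `|H| = p³ ≤ n^{3(2+δ)}`, has blocks of volume `≥ n^{3(2-δ)} ≥ |H|^{1/2}` (as
`3δ ≤ 2`) and packing sum `> p³` already at exponent `(2+ε₀)/3 ≤ (2+ε)/3` (monotonicity `sum_rpow_mono`).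
-/

-- single-conjunct summit: the mandated namespace repeats `MatrixMultiplication` (summit = sub-problem).
set_option linter.dupNamespace false

namespace Summit.MatrixMultiplication.MatrixMultiplication.Theorems.HomocyclicSTPPDesigns.LargeBlock

open Summit.MatrixMultiplication.MatrixMultiplication.Theses.FourierTwoFamiliesModP (PrimeTwoFamilies)
open Literature.Computability.AlgebraicComplexity Literature.Barriers.MatrixMultiplication
open scoped BigOperators

/-- **Prime two families give large-block abelian designs** (`α₀ = 1/2`): CKSU Conj. 4.7 with prime
cyclic hosts (`PrimeTwoFamilies`, stmt-MatrixMultiplication-14308) implies that for every `ε > 0` some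
finite abelian group `H` (namely `Fin 3 → ZMod p`) carries an STPP family beating exponent `(2+ε)/3`
whose every block has volume `≥ |H|^{1/2}` — the hypothesis of the large-block transfer
`homocyclicSTPPDesigns_of_largeBlockAbelianDesigns`.  Proof: the design lift `DesignLift.stub_designLift`
at `δ := ε₀/(8+ε₀)`, `ε₀ := min ε 1`; blocks `(|A_i||B_i|)(|A_j||B_j|)(|A_k||B_k|) ≥ n^{3(2-δ)} ≥
(n^{3(2+δ)})^{1/2} ≥ (p³)^{1/2}` since `3δ ≤ 2`; packing sum `≥ N·n^{(2-δ)(2+ε₀)} ≥ n^{(2-δ)+(2-δ)(2+ε₀)}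
> n^{3(2+δ)} ≥ p³` at exponent `(2+ε₀)/3`, and the sum is monotone in the exponent. -/
theorem largeBlockAbelianDesigns_of_primeTwoFamilies : PrimeTwoFamilies →
    ∃ α₀ : ℝ, 0 < α₀ ∧ ∀ ε : ℝ, 0 < ε →
      ∃ (H : Type) (_ : AddCommGroup H) (_ : Fintype H) (N : ℕ) (A B C : Fin N → Finset H),
        IsSTPP A B C ∧
        (∀ i, (Fintype.card H : ℝ) ^ α₀ ≤ (((A i).card * (B i).card * (C i).card : ℕ) : ℝ)) ∧
        (Fintype.card H : ℝ) <
          ∑ i, (((A i).card * (B i).card * (C i).card : ℕ) : ℝ) ^ ((2 + ε) / 3) := by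
  intro hTF
  refine ⟨1 / 2, by norm_num, fun ε hε => ?_⟩
  -- work at `ε₀ := min ε 1`
  set ε₀ : ℝ := min ε 1 with hε₀
  have hε₀pos : 0 < ε₀ := lt_min hε one_pos
  have hε₀le : ε₀ ≤ ε := min_le_left _ _
  have hε₀1 : ε₀ ≤ 1 := min_le_right _ _
  -- the slack `δ`
  obtain ⟨δ, hδ, hδ23, hkey⟩ :
      ∃ δ : ℝ, 0 < δ ∧ 3 * δ ≤ 2 ∧ 3 * (2 + δ) < (2 - δ) + (2 - δ) * (2 + ε₀) := by
    refine ⟨ε₀ / (8 + ε₀), by positivity, ?_, ?_⟩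
    · have h8 : (0 : ℝ) < 8 + ε₀ := by positivity
      have h1 : ε₀ / (8 + ε₀) ≤ ε₀ / 8 :=
        div_le_div_of_nonneg_left hε₀pos.le (by norm_num) (by linarith)
      linarith
    · have h8 : (8 : ℝ) + ε₀ ≠ 0 := by positivity
      have h1 : ε₀ / (8 + ε₀) * (8 + ε₀) = ε₀ := div_mul_cancel₀ ε₀ h8
      have h0 : 0 < ε₀ / (8 + ε₀) := by positivity
      nlinarith [h1, h0, hε₀pos]
  -- the lift threshold and the SDPP family
  obtain ⟨n₁, hn₁⟩ := DesignLift.stub_designLift δ hδ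
  obtain ⟨n, hn, p, hp, A, B, hW, hX, hpn, hAB⟩ := hTF δ hδ (n₁ + 2)
  obtain ⟨N, A', B', C', hS, hN, hprod⟩ := hn₁ n (by omega) (ZMod p) A B ⟨hW, hX⟩
  haveI : Fact p.Prime := ⟨hp⟩
  refine ⟨Fin 3 → ZMod p, inferInstance, inferInstance, N, A', B', C', hS, ?_, ?_⟩
  all_goals
    have hn1 : (1 : ℝ) < n := by exact_mod_cast (show 1 < n by omega)
    have hnpos : (0 : ℝ) < n := by linarith
    have hYpos : (0 : ℝ) < (n : ℝ) ^ (2 - δ) := Real.rpow_pos_of_pos hnpos _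
    have hcardH : (Fintype.card (Fin 3 → ZMod p) : ℝ) = (p : ℝ) ^ (3 : ℕ) := by
      rw [Fintype.card_fun, ZMod.card, Fintype.card_fin]; push_cast; ring
    -- the host: `p³ ≤ n^{3(2+δ)}`
    have hhost : (p : ℝ) ^ (3 : ℕ) ≤ (n : ℝ) ^ (3 * (2 + δ)) := by
      calc (p : ℝ) ^ 3 ≤ ((n : ℝ) ^ (2 + δ)) ^ 3 := by gcongr
        _ = (n : ℝ) ^ (3 * (2 + δ)) := by
            rw [← Real.rpow_natCast ((n : ℝ) ^ (2 + δ)) 3, ← Real.rpow_mul hnpos.le]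
            congr 1
            push_cast
            ring
    -- each block has volume `≥ (n^{2-δ})³`
    have hblock : ∀ v : Fin N, (n : ℝ) ^ (2 - δ) * (n : ℝ) ^ (2 - δ) * (n : ℝ) ^ (2 - δ) ≤
        (((A' v).card * (B' v).card * (C' v).card : ℕ) : ℝ) := by
      intro v
      obtain ⟨i, j, k, hijk⟩ := hprod v
      have hcast : (((A' v).card * (B' v).card * (C' v).card : ℕ) : ℝ) =
          (((A i).card * (B i).card : ℕ) : ℝ) * (((A j).card * (B j).card : ℕ) : ℝ) *
            (((A k).card * (B k).card : ℕ) : ℝ) := by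
        rw [hijk]; push_cast; ring
      have h1 := hAB i
      have h2 := hAB j
      have h3 := hAB k
      have h12 : (n : ℝ) ^ (2 - δ) * (n : ℝ) ^ (2 - δ) ≤
          (((A i).card * (B i).card : ℕ) : ℝ) * (((A j).card * (B j).card : ℕ) : ℝ) :=
        mul_le_mul h1 h2 hYpos.le (hYpos.le.trans h1)
      rw [hcast]
      calc (n : ℝ) ^ (2 - δ) * (n : ℝ) ^ (2 - δ) * (n : ℝ) ^ (2 - δ)
          ≤ (((A i).card * (B i).card : ℕ) : ℝ) * (((A j).card * (B j).card : ℕ) : ℝ) *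
              (n : ℝ) ^ (2 - δ) := mul_le_mul_of_nonneg_right h12 hYpos.le
        _ ≤ (((A i).card * (B i).card : ℕ) : ℝ) * (((A j).card * (B j).card : ℕ) : ℝ) *
              (((A k).card * (B k).card : ℕ) : ℝ) :=
            mul_le_mul_of_nonneg_left h3 ((mul_pos hYpos hYpos).le.trans h12)
    have hY3 : (n : ℝ) ^ (2 - δ) * (n : ℝ) ^ (2 - δ) * (n : ℝ) ^ (2 - δ) = (n : ℝ) ^ (3 * (2 - δ)) := by
      rw [← Real.rpow_add hnpos, ← Real.rpow_add hnpos]; congr 1; ring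
  · -- large blocks: `|H|^{1/2} ≤ n^{3(2+δ)/2} ≤ n^{3(2-δ)} ≤ vol`
    intro v
    rw [hcardH]
    calc ((p : ℝ) ^ (3 : ℕ)) ^ ((1 : ℝ) / 2) ≤ ((n : ℝ) ^ (3 * (2 + δ))) ^ ((1 : ℝ) / 2) :=
          Real.rpow_le_rpow (by positivity) hhost (by norm_num)
      _ = (n : ℝ) ^ (3 * (2 + δ) / 2) := by rw [← Real.rpow_mul hnpos.le]; congr 1; ring
      _ ≤ (n : ℝ) ^ (3 * (2 - δ)) := Real.rpow_le_rpow_of_exponent_le hn1.le (by linarith)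
      _ = (n : ℝ) ^ (2 - δ) * (n : ℝ) ^ (2 - δ) * (n : ℝ) ^ (2 - δ) := hY3.symm
      _ ≤ _ := hblock v
  · -- beating at `(2+ε₀)/3`, hence at `(2+ε)/3`
    have hterm : ∀ v : Fin N, (n : ℝ) ^ ((2 - δ) * (2 + ε₀)) ≤
        (((A' v).card * (B' v).card * (C' v).card : ℕ) : ℝ) ^ ((2 + ε₀) / 3) := by
      intro v
      have hpow : ((n : ℝ) ^ (2 - δ) * (n : ℝ) ^ (2 - δ) * (n : ℝ) ^ (2 - δ)) ^ ((2 + ε₀) / 3) =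
          (n : ℝ) ^ ((2 - δ) * (2 + ε₀)) := by
        rw [hY3, ← Real.rpow_mul hnpos.le]; congr 1; ring
      rw [← hpow]
      exact Real.rpow_le_rpow (by positivity) (hblock v) (by positivity)
    have hsum : (N : ℝ) * (n : ℝ) ^ ((2 - δ) * (2 + ε₀)) ≤
        ∑ v : Fin N, (((A' v).card * (B' v).card * (C' v).card : ℕ) : ℝ) ^ ((2 + ε₀) / 3) := by
      have h1 := Finset.sum_le_sum fun v (_ : v ∈ (Finset.univ : Finset (Fin N))) => hterm v
      rw [Finset.sum_const, Finset.card_univ, Fintype.card_fin, nsmul_eq_mul] at h1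
      exact h1
    have hlow : (n : ℝ) ^ ((2 - δ) + (2 - δ) * (2 + ε₀)) ≤ (N : ℝ) * (n : ℝ) ^ ((2 - δ) * (2 + ε₀)) := by
      rw [Real.rpow_add hnpos]
      exact mul_le_mul_of_nonneg_right hN (Real.rpow_nonneg hnpos.le _)
    have hlt : (n : ℝ) ^ (3 * (2 + δ)) < (n : ℝ) ^ ((2 - δ) + (2 - δ) * (2 + ε₀)) :=
      Real.rpow_lt_rpow_of_exponent_lt hn1 hkey
    have hmono := sum_rpow_mono (Finset.univ : Finset (Fin N))
      (fun v => (A' v).card * (B' v).card * (C' v).card) hε₀pos.le hε₀le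
    rw [hcardH]
    calc (p : ℝ) ^ (3 : ℕ) ≤ (n : ℝ) ^ (3 * (2 + δ)) := hhost
      _ < (n : ℝ) ^ ((2 - δ) + (2 - δ) * (2 + ε₀)) := hlt
      _ ≤ (N : ℝ) * (n : ℝ) ^ ((2 - δ) * (2 + ε₀)) := hlow
      _ ≤ ∑ v : Fin N, (((A' v).card * (B' v).card * (C' v).card : ℕ) : ℝ) ^ ((2 + ε₀) / 3) := hsum
      _ ≤ ∑ v : Fin N, (((A' v).card * (B' v).card * (C' v).card : ℕ) : ℝ) ^ ((2 + ε) / 3) := hmono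

end Summit.MatrixMultiplication.MatrixMultiplication.Theorems.HomocyclicSTPPDesigns.LargeBlock
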